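import Literature.NumberTheory.Sieve.HeathBrownCubicTypeIIForms
import HarnessLib

/-!
# Heath-Brown's Lemma 3.10, §12 pp. 72–75: localisation of `D`, hypercubes, Classes I/II, `S₅`, `S₆`

Support for the proof of **Lemma 3.10** of D. R. Heath-Brown, *Primes represented by `x³ + 2y³`*,
Acta Math. 186 (2001), §12:

> "In order to remove the dependence of the region `ℛ_D` on the modulus `D`, we shall decompose the range
> for `D` firstly into intervals `A < D ≤ 2A`, and then into subintervals `D ∈ I_m = ((m−1)A/N, mA/N]`,
> `N < m ≤ 2N` (12.1). Here `N ≪ X^{2τ/3}` (12.2) is a large integer parameter … there is at least one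
> pair of values `A, m` for which `S₄ ≪ N(log X)S₅`, where `S₅ = ∑_{D ∈ I_m} ∑_{(β₁,β₂) ∈ ℛ_D, D = h.c.f.(𝐯)} F_{β₁}F_{β₂}`.
> We now proceed to cover the region of summation by means of hypercubes `C(n₁,n₂,n₃) × C(n₄,n₅,n₆)`,
> where `C(n_i,n_j,n_k) = I(n_i) × I(n_j) × I(n_k)` (12.3) with `I(n) = (V^{1/3}(n−1)/N, V^{1/3}n/N]` (12.4).
> … We shall say that a hypercube is of Class I if it lies completely inside `ℛ_D` for each `D ∈ I_m`,
> and of Class II if there is at least one `D ∈ I_m` for which `ℛ_D ∩ (C₁ × C₂) ≠ ∅` and `C₁ × C₂ ⊄ ℛ_D`.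
> Hypercubes which are neither of Class I nor of Class II clearly make no contribution to `S₅` … LEMMA 12.1.
> … there are cubes … such that `S₅ ≪ N⁶S₆ + N⁵(log X)²S₇` with `S₆ = ∑_{D ∈ I_m} ∑_{β̂_i ∈ C_i, D = h.c.f.(𝐯)} F_{β₁}F_{β₂}`
> and `S₇ = ∑_{D ∈ I_m} ∑_{β̂_i ∈ C'_i, D ∣ 𝐯} τ(β₁)²`. The hypercube `C₁ × C₂` is of Class I, so that
> `C₁` and `C₂` are distinct, and therefore disjoint."

We localise `D` multiplicatively in one step (cells `t = ⌊N log D⌋`, in which `D` varies by a factor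
`< e^{1/N}`; this replaces the pairs `(A, m)`, of which there are likewise `≪ N log X`), and cover by the
hypercubes of side `s = T/N = V^{1/3}/N`. All PROVED:

* `PP` (the pairs of `S₄⁺` with nonzero weight), `S4plus_eq_sum_PP`; `cubeIdx`, `corner`, `LC`
  (the lattice points of `C(𝐧)`), `mem_LC_iff`, `realCell`; `tIdx`, `cellOf`, `Trange`, `Nrange`,
  `cellOf_mem` (every pair lands in `Trange × Nrange²`, using `D ≤ 270V/X`), **`S5`** and
  **`S4plus_eq_sum_S5`** (`S₄⁺ = ∑_{cells} S₅`);
* the real conditions `GoodB` (`T < ell ≤ ET`, `V < N ≤ 2V`), `RDR` (`XD < p_i, q_i ≤ XD(1+η)`),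
  `Drange`, and the classes `ClassI`, `Class0` (Class II = neither);
* **`S5_eq_zero_of_class0`**, **`S5_eq_S6_of_classI`** with
  `S6 = ∑_{β̂_i ∈ C_i primitive, D > Δ₀, cell(D) = t} f_{(β₁)} f_{(β₂)}` (on a Class I hypercube `F_β = f_{(β)}`
  and all of `ℛ_D` holds; `C₁ ≠ C₂`), and for every hypercube
  **`abs_S5_le_S7`**: `|S₅| ≤ (81/2)(S₇ + S₇')`, `S₇ = ∑_{D} ∑_{β̂₁ ∈ C₁ prim} ∑_{β̂₂ ∈ C₂, D ∣ 𝐯} τ(β₁)²`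
  (ready for Lemma 11.1), `Dset` (the `D` of a cell) with `sum_Dset_inv_sq_le` (`∑_{D} D⁻² ≤ 5/(NΔ₀)`),
  `card_Trange_le`, `card_Nrange_le`.

## References

* D. R. Heath-Brown, *Primes represented by `x³ + 2y³`*, Acta Math. 186 (2001), §12 pp. 72–75,
  (12.1)–(12.4), Lemma 12.1. [cite: HeathBrownActa2001, Lemma 12.1]
* G. Harman, *Prime-Detecting Sieves* (2007), §13.8 p. 281. [cite: Harman2007, §13.8]

## Mathlib / tree search

Tree: `HeathBrownCubicTypeIIForms` (`aplus`, `RDplus`, `Wplus_iff_RDplus`, `S4plus`, `p1R`, …,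
`Dhcf_le_of_Wab`), `HeathBrownCubicTypeIIOffDiag`, `HeathBrownCubicTypeIICauchy` (`Fb`, `Bbox`, `cube`),
`HeathBrownCubicTypeII` (`latticeCube`, `fWeight`). Mathlib: `Finset.sum_fiberwise_of_maps_to`,
`Int.ceil_eq_iff`, `Real.add_one_le_exp`, `Real.abs_exp_sub_one_sub_id_le`, `Nat.floor`.
-/

noncomputable section

open Finset NumberField

namespace Literature.NumberTheory.Sieve.CubicSieve

open LFunctions.CubeRootTwoField CubicPrimes

/-! ### The pairs of `S₄⁺`, hypercubes and cells -/

section Defs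

variable (X η τ : ℝ) {k : ℕ} (m : Fin k → ℕ) (V T : ℝ)

open scoped Classical in
/-- The pairs `(β̂₁, β̂₂)` of `S₄⁺` with nonzero weight: `β₁ ≠ β₂` in `Bbox`, `D > Δ₀`,
`W(α̂⁺β̂₁)W(α̂⁺β̂₂) = 1`, `F_{β₁}, F_{β₂} ≠ 0`. [cite: HeathBrownActa2001, §12 p. 72] -/
def PP (Δ₀ : ℝ) : Finset ((ℤ × ℤ × ℤ) × (ℤ × ℤ × ℤ)) :=
  ((Bbox T).offDiag).filter fun bb => Δ₀ < (Dhcf bb : ℝ) ∧ (Wab X η (aplus bb) bb.1 ∧ Wab X η (aplus bb) bb.2) ∧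
    Fb X τ m V T bb.1 ≠ 0 ∧ Fb X τ m V T bb.2 ≠ 0

end Defs

/-- **The hypercube index** `𝐧 = ⌈β̂/s⌉` (componentwise): `β̂ ∈ C(𝐧) = ∏ (s(n_i − 1), s n_i]` ((12.3), (12.4)
with `s = V^{1/3}/N`). [cite: HeathBrownActa2001, §12 (12.3)] -/
def cubeIdx (s : ℝ) (b : ℤ × ℤ × ℤ) : ℤ × ℤ × ℤ := (⌈(b.1 : ℝ) / s⌉, ⌈(b.2.1 : ℝ) / s⌉, ⌈(b.2.2 : ℝ) / s⌉)

/-- The lower corner `s(𝐧 − 1)` of the hypercube `C(𝐧)`. [cite: HeathBrownActa2001, §12 (12.3)] -/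
def corner (s : ℝ) (n : ℤ × ℤ × ℤ) : ℝ × ℝ × ℝ := (s * ((n.1 : ℝ) - 1), s * ((n.2.1 : ℝ) - 1), s * ((n.2.2 : ℝ) - 1))

/-- **`C(𝐧) ∩ ℤ³`**, the lattice points of the hypercube (a `latticeCube` of side `s`). [cite: HeathBrownActa2001, §12 (12.3)] -/
def LC (s : ℝ) (n : ℤ × ℤ × ℤ) : Finset (ℤ × ℤ × ℤ) := latticeCube (corner s n) s

/-- The closed real hypercube `∏ [s(n_i − 1), s n_i]`. [cite: HeathBrownActa2001, §12 (12.3)] -/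
def realCell (s : ℝ) (n : ℤ × ℤ × ℤ) : Set (ℝ × ℝ × ℝ) :=
  {p | (s * ((n.1 : ℝ) - 1) ≤ p.1 ∧ p.1 ≤ s * n.1) ∧ (s * ((n.2.1 : ℝ) - 1) ≤ p.2.1 ∧ p.2.1 ≤ s * n.2.1) ∧
    (s * ((n.2.2 : ℝ) - 1) ≤ p.2.2 ∧ p.2.2 ≤ s * n.2.2)}

/-- One coordinate of `mem_LC_iff`. [folklore] -/
theorem mem_Ioc_floor_iff_ceil_eq {s : ℝ} (hs : 0 < s) (z n : ℤ) :
    z ∈ Ioc ⌊s * ((n : ℝ) - 1)⌋ ⌊s * ((n : ℝ) - 1) + s⌋ ↔ ⌈(z : ℝ) / s⌉ = n := by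
  rw [mem_Ioc, Int.floor_lt, Int.le_floor, Int.ceil_eq_iff, div_le_iff₀ hs, lt_div_iff₀ hs]
  constructor
  · rintro ⟨h1, h2⟩; constructor <;> nlinarith
  · rintro ⟨h1, h2⟩; constructor <;> nlinarith

/-- **`β̂ ∈ C(𝐧) ↔ ⌈β̂/s⌉ = 𝐧`.** [cite: HeathBrownActa2001, §12 (12.3)] -/
theorem mem_LC_iff {s : ℝ} (hs : 0 < s) {b n : ℤ × ℤ × ℤ} : b ∈ LC s n ↔ cubeIdx s b = n := by
  rw [LC, latticeCube, corner, mem_product, mem_product]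
  simp only
  rw [mem_Ioc_floor_iff_ceil_eq hs, mem_Ioc_floor_iff_ceil_eq hs, mem_Ioc_floor_iff_ceil_eq hs, cubeIdx,
    Prod.ext_iff, Prod.ext_iff]

/-- Lattice points of `C(𝐧)` are real points of the closed hypercube. [folklore] -/
theorem castVec_mem_realCell {s : ℝ} (hs : 0 < s) {b n : ℤ × ℤ × ℤ} (h : b ∈ LC s n) :
    castVec b ∈ realCell s n := by
  rw [mem_LC_iff hs, cubeIdx, Prod.ext_iff, Prod.ext_iff] at h
  simp only at h
  obtain ⟨h1, h2, h3⟩ := h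
  have key : ∀ (z m : ℤ), ⌈(z : ℝ) / s⌉ = m → s * ((m : ℝ) - 1) ≤ (z : ℝ) ∧ (z : ℝ) ≤ s * m := by
    intro z m hz
    rw [Int.ceil_eq_iff, div_le_iff₀ hs, lt_div_iff₀ hs] at hz
    constructor <;> nlinarith
  exact ⟨key _ _ h1, key _ _ h2, key _ _ h3⟩

/-- The corner belongs to the closed hypercube (`s ≥ 0`). [folklore] -/
theorem corner_mem_realCell {s : ℝ} (hs : 0 ≤ s) (n : ℤ × ℤ × ℤ) :
    (s * (n.1 : ℝ), s * (n.2.1 : ℝ), s * (n.2.2 : ℝ)) ∈ realCell s n := by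
  refine ⟨⟨by nlinarith, le_rfl⟩, ⟨by nlinarith, le_rfl⟩, ⟨by nlinarith, le_rfl⟩⟩

/-- **The cell of `D`**: `t = ⌊N log D⌋` (so `e^{t/N} ≤ D < e^{(t+1)/N}`; our substitute for the pairs
`(A, m)` of (12.1)). [cite: HeathBrownActa2001, §12 (12.1)] -/
def tIdx (N : ℕ) (D : ℕ) : ℕ := ⌊(N : ℝ) * Real.log D⌋₊

/-- The cell of a pair: `(t, 𝐧, 𝐧')`. [cite: HeathBrownActa2001, §12 p. 73] -/
def cellOf (N : ℕ) (s : ℝ) (bb : (ℤ × ℤ × ℤ) × (ℤ × ℤ × ℤ)) : ℕ × ((ℤ × ℤ × ℤ) × (ℤ × ℤ × ℤ)) :=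
  (tIdx N (Dhcf bb), cubeIdx s bb.1, cubeIdx s bb.2)

/-- The range of `t` for `Δ₀ < D ≤ D_max`. [folklore] -/
def Trange (N : ℕ) (Δ₀ Dmax : ℝ) : Finset ℕ := Icc ⌊(N : ℝ) * Real.log Δ₀⌋₊ ⌊(N : ℝ) * Real.log Dmax⌋₊

/-- The range of `𝐧` for `β̂ ∈ Bbox`: `|n_i| ≤ 3N + 1`. [folklore] -/
def Nrange (N : ℕ) : Finset (ℤ × ℤ × ℤ) := cube (3 * N + 1)

/-- `tIdx` is monotone in real bounds: `Δ₀ < D ≤ D_max` puts `tIdx N D ∈ Trange` (`Δ₀ ≥ 1`). [folklore] -/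
theorem tIdx_mem_Trange {N : ℕ} {Δ₀ Dmax : ℝ} (hΔ : 1 ≤ Δ₀) {D : ℕ} (h1 : Δ₀ < D) (h2 : (D : ℝ) ≤ Dmax) :
    tIdx N D ∈ Trange N Δ₀ Dmax := by
  rw [Trange, mem_Icc, tIdx]
  have hD0 : (0 : ℝ) < D := by linarith
  have hlog1 : Real.log Δ₀ ≤ Real.log D := Real.log_le_log (by linarith) h1.le
  have hlog2 : Real.log D ≤ Real.log Dmax := Real.log_le_log hD0 h2
  constructor
  · exact Nat.floor_le_floor (by gcongr)
  · exact Nat.floor_le_floor (by gcongr)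

/-- `cubeIdx s b ∈ Nrange N` for `b ∈ Bbox T`, `s = T/N`. [folklore] -/
theorem cubeIdx_mem_Nrange {T : ℝ} (hT : 0 < T) {N : ℕ} (hN : 0 < N) {b : ℤ × ℤ × ℤ} (hb : b ∈ Bbox T) :
    cubeIdx (T / N) b ∈ Nrange N := by
  obtain ⟨h1, h2, h3⟩ := abs_le_of_mem_cube hb
  have hNR : (0 : ℝ) < N := by exact_mod_cast hN
  have hs : 0 < T / N := by positivity
  have key : ∀ z : ℤ, |(z : ℝ)| ≤ 3 * T → |((⌈(z : ℝ) / (T / N)⌉ : ℤ) : ℝ)| ≤ 3 * N + 1 := by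
    intro z hz
    rw [abs_le] at hz ⊢
    have hdiv : (z : ℝ) / (T / N) = z * N / T := by field_simp
    have hlo : -(3 * (N : ℝ)) ≤ (z : ℝ) / (T / N) := by
      rw [hdiv, le_div_iff₀ hT]; nlinarith
    have hhi : (z : ℝ) / (T / N) ≤ 3 * N := by
      rw [hdiv, div_le_iff₀ hT]; nlinarith
    constructor
    · have : (⌈(z : ℝ) / (T / N)⌉ : ℝ) ≥ (z : ℝ) / (T / N) := Int.le_ceil _
      linarith
    · have : (⌈(z : ℝ) / (T / N)⌉ : ℝ) < (z : ℝ) / (T / N) + 1 := Int.ceil_lt_add_one _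
      linarith
  rw [Nrange]
  exact mem_cube_of_abs_le (key _ h1) (key _ h2) (key _ h3)

/-- `#Nrange N ≤ (6N + 3)³`. [folklore] -/
theorem card_Nrange_le (N : ℕ) : (#(Nrange N) : ℝ) ≤ (6 * N + 3) ^ 3 := by
  rw [Nrange]
  refine (card_cube_le (by positivity)).trans (le_of_eq ?_)
  ring

/-- `#Trange ≤ N log(D_max/Δ₀) + 2` (for `1 ≤ Δ₀ ≤ D_max`). [folklore] -/
theorem card_Trange_le {N : ℕ} {Δ₀ Dmax : ℝ} (hΔ : 1 ≤ Δ₀) (hΔD : Δ₀ ≤ Dmax) :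
    (#(Trange N Δ₀ Dmax) : ℝ) ≤ N * (Real.log Dmax - Real.log Δ₀) + 2 := by
  rw [Trange, Nat.card_Icc]
  set A : ℝ := (N : ℝ) * Real.log Δ₀ with hA
  set B : ℝ := (N : ℝ) * Real.log Dmax with hB
  have h0 : 0 ≤ A := mul_nonneg (Nat.cast_nonneg _) (Real.log_nonneg hΔ)
  have h1 : 0 ≤ B := mul_nonneg (Nat.cast_nonneg _) (Real.log_nonneg (hΔ.trans hΔD))
  have hlogle : Real.log Δ₀ ≤ Real.log Dmax := Real.log_le_log (by linarith) hΔD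
  have hAB : A ≤ B := by rw [hA, hB]; gcongr
  have hfl : ⌊A⌋₊ ≤ ⌊B⌋₊ := Nat.floor_le_floor hAB
  rw [Nat.cast_sub (by omega)]
  push_cast
  have a := Nat.floor_le h1
  have b := Nat.lt_floor_add_one A
  rw [hA, hB] at *
  linarith

variable {X η τ V T : ℝ} {k : ℕ} {m : Fin k → ℕ}

open scoped Classical in
/-- `S₄⁺` as the sum of `F_{β₁}F_{β₂}` over `PP` (the other terms vanish). [cite: HeathBrownActa2001, §12 p. 72] -/
theorem S4plus_eq_sum_PP (Δ₀ : ℝ) :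
    S4plus X η τ m V T Δ₀ = ∑ bb ∈ PP X η τ m V T Δ₀, Fb X τ m V T bb.1 * Fb X τ m V T bb.2 := by
  classical
  rw [S4plus, PP]
  rw [← sum_filter_of_ne (p := fun bb => (Wab X η (aplus bb) bb.1 ∧ Wab X η (aplus bb) bb.2) ∧
      Fb X τ m V T bb.1 ≠ 0 ∧ Fb X τ m V T bb.2 ≠ 0)]
  · rw [filter_filter]
    refine sum_congr ?_ fun bb hbb => ?_
    · rfl
    · rw [mem_filter] at hbb; rw [if_pos hbb.2.2.1]
  · intro bb _ hne
    by_cases hW : Wab X η (aplus bb) bb.1 ∧ Wab X η (aplus bb) bb.2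
    · rw [if_pos hW] at hne
      exact ⟨hW, (mul_ne_zero_iff.mp hne).1, (mul_ne_zero_iff.mp hne).2⟩
    · rw [if_neg hW] at hne; exact absurd rfl hne

/-- Facts about a pair in `PP`. [folklore] -/
theorem PP_facts (hX : 0 < X) (hT : 0 < T) (hTV : T ^ 3 = V) {Δ₀ : ℝ} {bb : (ℤ × ℤ × ℤ) × (ℤ × ℤ × ℤ)}
    (h : bb ∈ PP X η τ m V T Δ₀) :
    bb ∈ (Bbox T).offDiag ∧ Δ₀ < (Dhcf bb : ℝ) ∧ (Wab X η (aplus bb) bb.1 ∧ Wab X η (aplus bb) bb.2) ∧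
      Fb X τ m V T bb.1 ≠ 0 ∧ Fb X τ m V T bb.2 ≠ 0 ∧ (Dhcf bb : ℝ) ≤ 270 * V / X := by
  classical
  rw [PP, mem_filter] at h
  obtain ⟨hoff, hD, hW, hF1, hF2⟩ := h
  exact ⟨hoff, hD, hW, hF1, hF2, Dhcf_le_of_Wab hX hT hTV hoff hW.1⟩

/-- Every pair of `PP` lands in `Trange × Nrange²`. [folklore] -/
theorem cellOf_mem (hX : 0 < X) (hT : 0 < T) (hTV : T ^ 3 = V) {N : ℕ} (hN : 0 < N) {Δ₀ : ℝ} (hΔ : 1 ≤ Δ₀)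
    {bb : (ℤ × ℤ × ℤ) × (ℤ × ℤ × ℤ)} (h : bb ∈ PP X η τ m V T Δ₀) :
    cellOf N (T / N) bb ∈ Trange N Δ₀ (270 * V / X) ×ˢ (Nrange N ×ˢ Nrange N) := by
  obtain ⟨hoff, hD, -, -, -, hDmax⟩ := PP_facts hX hT hTV h
  obtain ⟨hb1, hb2, -⟩ := mem_offDiag.mp hoff
  rw [cellOf, mem_product, mem_product]
  exact ⟨tIdx_mem_Trange hΔ hD hDmax, cubeIdx_mem_Nrange hT hN hb1, cubeIdx_mem_Nrange hT hN hb2⟩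

section Defs2

variable (X η τ : ℝ) {k : ℕ} (m : Fin k → ℕ) (V T : ℝ) (N : ℕ) (Δ₀ : ℝ)

open scoped Classical in
/-- **`S₅(t, 𝐧, 𝐧')`**: the part of `S₄⁺` from the pairs in the cell. [cite: HeathBrownActa2001, Lemma 12.1] -/
def S5 (c : ℕ × ((ℤ × ℤ × ℤ) × (ℤ × ℤ × ℤ))) : ℝ :=
  ∑ bb ∈ (PP X η τ m V T Δ₀).filter (fun bb => cellOf N (T / N) bb = c), Fb X τ m V T bb.1 * Fb X τ m V T bb.2

open scoped Classical in
/-- **`S₆(t, 𝐧, 𝐧')`**: `∑_{β̂_i ∈ C_i primitive, D > Δ₀, cell(D) = t} f_{(β₁)} f_{(β₂)}` — the Class I form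
("`S₆ = ∑_{D ∈ I_m} ∑_{β̂_i ∈ C_i, D = h.c.f.(𝐯)} F_{β₁}F_{β₂}`", Lemma 12.1). [cite: HeathBrownActa2001, Lemma 12.1] -/
def S6 (t : ℕ) (n n' : ℤ × ℤ × ℤ) : ℝ :=
  ∑ bb ∈ (LC (T / N) n ×ˢ LC (T / N) n').filter (fun bb => IsPrimitiveVec bb.1 ∧ IsPrimitiveVec bb.2 ∧
      Δ₀ < (Dhcf bb : ℝ) ∧ tIdx N (Dhcf bb) = t),
    fWeight X τ m (Ideal.span {coordElt bb.1}) * fWeight X τ m (Ideal.span {coordElt bb.2})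

open scoped Classical in
/-- The `D` of the cell `t`: `Δ₀ < D ≤ 270V/X`, `⌊N log D⌋ = t`. [cite: HeathBrownActa2001, §12 (12.1)] -/
def Dset (t : ℕ) : Finset ℕ :=
  (Icc 1 ⌊270 * V / X⌋₊).filter fun D => Δ₀ < (D : ℝ) ∧ tIdx N D = t

end Defs2

/-- **`S₄⁺ = ∑_{cells} S₅`.** [cite: HeathBrownActa2001, Lemma 12.1] -/
theorem S4plus_eq_sum_S5 (hX : 0 < X) (hT : 0 < T) (hTV : T ^ 3 = V) {N : ℕ} (hN : 0 < N) {Δ₀ : ℝ} (hΔ : 1 ≤ Δ₀) :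
    S4plus X η τ m V T Δ₀ =
      ∑ c ∈ Trange N Δ₀ (270 * V / X) ×ˢ (Nrange N ×ˢ Nrange N), S5 X η τ m V T N Δ₀ c := by
  classical
  rw [S4plus_eq_sum_PP]
  simp only [S5]
  exact (sum_fiberwise_of_maps_to (fun bb hbb => cellOf_mem hX hT hTV hN hΔ hbb) _).symm

/-! ### The real conditions and the classes -/

/-- **`β` good**: `T < σ₁(β) ≤ ET` (the window, (11.3)) and `V < N(β) ≤ 2V`. [cite: HeathBrownActa2001, §12 p. 72] -/
def GoodB (T V : ℝ) (p : ℝ × ℝ × ℝ) : Prop :=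
  (T < ell p ∧ ell p ≤ unitE * T) ∧ (V < normForm p ∧ normForm p ≤ 2 * V)

/-- **The coupled conditions `XD < p_i(β₁,β₂), q_i(β₁,β₂) ≤ XD(1+η)`** as real conditions. [cite: HeathBrownActa2001, §12 p. 72] -/
def RDR (X η D : ℝ) (p₁ p₂ : ℝ × ℝ × ℝ) : Prop :=
  (X * D < p1R p₁ p₂ ∧ p1R p₁ p₂ ≤ X * (1 + η) * D) ∧ (X * D < q1R p₁ p₂ ∧ q1R p₁ p₂ ≤ X * (1 + η) * D) ∧
  (X * D < p2R p₁ p₂ ∧ p2R p₁ p₂ ≤ X * (1 + η) * D) ∧ (X * D < q2R p₁ p₂ ∧ q2R p₁ p₂ ≤ X * (1 + η) * D)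

/-- The real range of `D` in the cell `t`: `e^{t/N} ≤ D ≤ e^{(t+1)/N}`. [cite: HeathBrownActa2001, §12 (12.1)] -/
def Drange (N t : ℕ) : Set ℝ := {D | Real.exp ((t : ℝ) / N) ≤ D ∧ D ≤ Real.exp (((t : ℝ) + 1) / N)}

/-- **Class I**: every real point of the hypercube satisfies all of `ℛ_D` for every `D` of the cell.
[cite: HeathBrownActa2001, §12 p. 73] -/
def ClassI (X η T V : ℝ) (N t : ℕ) (n n' : ℤ × ℤ × ℤ) : Prop :=
  ∀ p₁ ∈ realCell (T / N) n, ∀ p₂ ∈ realCell (T / N) n',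
    GoodB T V p₁ ∧ GoodB T V p₂ ∧ ∀ D ∈ Drange N t, RDR X η D p₁ p₂

/-- **Class 0** (neither I nor II): no real point of the hypercube satisfies `ℛ_D` for any `D` of the cell.
[cite: HeathBrownActa2001, §12 p. 73] -/
def Class0 (X η T V : ℝ) (N t : ℕ) (n n' : ℤ × ℤ × ℤ) : Prop :=
  ∀ p₁ ∈ realCell (T / N) n, ∀ p₂ ∈ realCell (T / N) n', ∀ D ∈ Drange N t,
    ¬ (GoodB T V p₁ ∧ GoodB T V p₂ ∧ RDR X η D p₁ p₂)

/-- An integer `D ≥ 1` with `tIdx N D = t` lies in `Drange N t` (`N ≥ 1`). [folklore] -/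
theorem mem_Drange_of_tIdx {N : ℕ} (hN : 0 < N) {D : ℕ} (hD : 1 ≤ D) {t : ℕ} (ht : tIdx N D = t) :
    (D : ℝ) ∈ Drange N t := by
  have hNR : (0 : ℝ) < N := by exact_mod_cast hN
  have hD0 : (0 : ℝ) < D := by exact_mod_cast hD
  have hlog0 : 0 ≤ Real.log D := Real.log_nonneg (by exact_mod_cast hD)
  rw [tIdx] at ht
  have h1 : (t : ℝ) ≤ (N : ℝ) * Real.log D := by rw [← ht]; exact Nat.floor_le (by positivity)
  have h2 : (N : ℝ) * Real.log D < t + 1 := by rw [← ht]; exact Nat.lt_floor_add_one _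
  constructor
  · calc Real.exp ((t : ℝ) / N) ≤ Real.exp (Real.log D) := by
          apply Real.exp_le_exp.mpr; rw [div_le_iff₀ hNR]; linarith
      _ = D := Real.exp_log hD0
  · calc (D : ℝ) = Real.exp (Real.log D) := (Real.exp_log hD0).symm
      _ ≤ Real.exp (((t : ℝ) + 1) / N) := by
          apply Real.exp_le_exp.mpr; rw [le_div_iff₀ hNR]; linarith

/-- For `β` in the window: `GoodB` at `β̂` is exactly "window and `V < N((β)) ≤ 2V`". [folklore] -/
theorem goodB_castVec_iff (hT : 0 < T) {b : ℤ × ℤ × ℤ} (hw : InWindow T (coordElt b)) :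
    GoodB T V (castVec b) ↔ (V < (Ideal.absNorm (Ideal.span {coordElt b}) : ℝ) ∧
      (Ideal.absNorm (Ideal.span {coordElt b}) : ℝ) ≤ 2 * V) := by
  have hN := absNorm_eq_normForm_of_inWindow hT hw
  have hw' : T < ell (castVec b) ∧ ell (castVec b) ≤ unitE * T := by
    have h1 := hw.1; have h2 := hw.2; rw [ellO_coordElt] at h1 h2; exact ⟨h1, h2⟩
  rw [GoodB, hN]
  tauto

/-- `RDR` at lattice points is `RDplus`. [folklore] -/
theorem RDR_castVec_iff (X η : ℝ) (bb : (ℤ × ℤ × ℤ) × (ℤ × ℤ × ℤ)) :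
    RDR X η (Dhcf bb) (castVec bb.1) (castVec bb.2) ↔ RDplus X η bb := by
  rw [RDR, RDplus, p1R_castVec, q1R_castVec, p2R_castVec, q2R_castVec]

/-- A pair of `PP` in the cell `(t, 𝐧, 𝐧')` yields real points of the hypercube satisfying everything.
[cite: HeathBrownActa2001, §12 p. 73] -/
theorem witnesses_of_PP (hX : 0 < X) (hη1 : η ≤ 1) (hT : 0 < T) (hTV : T ^ 3 = V) {N : ℕ} (hN : 0 < N)
    {Δ₀ : ℝ} {bb : (ℤ × ℤ × ℤ) × (ℤ × ℤ × ℤ)} (h : bb ∈ PP X η τ m V T Δ₀) :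
    castVec bb.1 ∈ realCell (T / N) (cubeIdx (T / N) bb.1) ∧ castVec bb.2 ∈ realCell (T / N) (cubeIdx (T / N) bb.2) ∧
      (Dhcf bb : ℝ) ∈ Drange N (tIdx N (Dhcf bb)) ∧ GoodB T V (castVec bb.1) ∧ GoodB T V (castVec bb.2) ∧
        RDR X η (Dhcf bb) (castVec bb.1) (castVec bb.2) := by
  obtain ⟨hoff, -, hW, hF1, hF2, -⟩ := PP_facts hX hT hTV h
  have hNR : (0 : ℝ) < N := by exact_mod_cast hN
  have hs : 0 < T / N := by positivity
  obtain ⟨hw1, hp1, hN1⟩ := support_of_Fb_ne_zero hF1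
  obtain ⟨hw2, hp2, hN2⟩ := support_of_Fb_ne_zero hF2
  have hne : bb.1 ≠ bb.2 := (mem_offDiag.mp hoff).2.2
  have hv : cross3 bb.1 bb.2 ≠ 0 := cross3_ne_zero_of_Wab hX.le hη1 hp1 hne hW.1 hW.2
  refine ⟨castVec_mem_realCell hs ((mem_LC_iff hs).mpr rfl), castVec_mem_realCell hs ((mem_LC_iff hs).mpr rfl),
    mem_Drange_of_tIdx hN (one_le_hcf3 hv) rfl, (goodB_castVec_iff hT hw1).mpr hN1,
    (goodB_castVec_iff hT hw2).mpr hN2, ?_⟩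
  rw [RDR_castVec_iff]
  exact (Wplus_iff_RDplus hX.le hv).mp hW

open scoped Classical in
/-- **Class 0 hypercubes contribute nothing** ("Hypercubes which are neither of Class I nor of Class II
clearly make no contribution to `S₅`"). [cite: HeathBrownActa2001, §12 p. 73] -/
theorem S5_eq_zero_of_class0 (hX : 0 < X) (hη1 : η ≤ 1) (hT : 0 < T) (hTV : T ^ 3 = V) {N : ℕ} (hN : 0 < N)
    {Δ₀ : ℝ} {t : ℕ} {n n' : ℤ × ℤ × ℤ} (h0 : Class0 X η T V N t n n') :
    S5 X η τ m V T N Δ₀ (t, n, n') = 0 := by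
  classical
  rw [S5]
  refine sum_eq_zero fun bb hbb => ?_
  exfalso
  rw [mem_filter] at hbb
  obtain ⟨hPP, hcell⟩ := hbb
  rw [cellOf, Prod.ext_iff, Prod.ext_iff] at hcell
  obtain ⟨ht, hn, hn'⟩ := hcell
  simp only at ht hn hn'
  obtain ⟨c1, c2, hD, g1, g2, hR⟩ := witnesses_of_PP hX hη1 hT hTV hN hPP
  rw [hn] at c1; rw [hn'] at c2; rw [ht] at hD
  exact h0 _ c1 _ c2 _ hD ⟨g1, g2, hR⟩

/-! ### Class I hypercubes: `S₅ = S₆` -/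

/-- `p₁(β, β) = 0` (so a hypercube `C × C` is never of Class I). [cite: HeathBrownActa2001, §12 p. 72] -/
theorem p1R_self (p : ℝ × ℝ × ℝ) : p1R p p = 0 := by
  simp only [p1R, dotR, gradPR, adjAR, adjBR, adjCR]; ring

/-- **"The hypercube `C₁ × C₂` is of Class I, so that `C₁` and `C₂` are distinct"** (`X > 0`).
[cite: HeathBrownActa2001, Lemma 12.1] -/
theorem ne_of_classI (hX : 0 < X) (hT : 0 ≤ T) {N t : ℕ} {n n' : ℤ × ℤ × ℤ} (h : ClassI X η T V N t n n') :
    n ≠ n' := by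
  rintro rfl
  have hs : 0 ≤ T / N := by positivity
  set p : ℝ × ℝ × ℝ := (T / N * (n.1 : ℝ), T / N * (n.2.1 : ℝ), T / N * (n.2.2 : ℝ)) with hp
  have hpc : p ∈ realCell (T / N) n := corner_mem_realCell hs n
  have hD : Real.exp ((t : ℝ) / N) ∈ Drange N t :=
    ⟨le_rfl, Real.exp_le_exp.mpr (by gcongr; linarith)⟩
  obtain ⟨-, -, hR⟩ := h p hpc p hpc
  have h1 := (hR _ hD).1.1
  rw [p1R_self] at h1
  have : 0 < X * Real.exp ((t : ℝ) / N) := mul_pos hX (Real.exp_pos _)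
  linarith

/-- On a real point of a Class I hypercube, `GoodB` holds; at a lattice point this is the window and the
norm condition. [folklore] -/
theorem window_of_goodB {b : ℤ × ℤ × ℤ} (hg : GoodB T V (castVec b)) : InWindow T (coordElt b) := by
  obtain ⟨⟨h1, h2⟩, -⟩ := hg
  refine ⟨?_, ?_⟩ <;> rw [ellO_coordElt]
  · exact h1
  · exact h2

open scoped Classical in
/-- **On a Class I hypercube `S₅ = S₆`**: every lattice pair in `C₁ × C₂` with primitive coordinates and
`D` in the cell satisfies all of `ℛ_D`, has `β_i` in the window and `V < N(β_i) ≤ 2V`, so that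
`F_{β_i} = f_{(β_i)}`; and `C₁ ≠ C₂`. [cite: HeathBrownActa2001, Lemma 12.1] -/
theorem S5_eq_S6_of_classI (hX : 0 < X) (hT : 0 < T) (hTV : T ^ 3 = V) {N : ℕ} (hN : 0 < N)
    {Δ₀ : ℝ} {t : ℕ} {n n' : ℤ × ℤ × ℤ} (hI : ClassI X η T V N t n n') :
    S5 X η τ m V T N Δ₀ (t, n, n') = S6 X τ m T N Δ₀ t n n' := by
  classical
  have hNR : (0 : ℝ) < N := by exact_mod_cast hN
  have hs : 0 < T / N := by positivity
  have hnn' : n ≠ n' := ne_of_classI hX hT.le hI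
  set Q := (LC (T / N) n ×ˢ LC (T / N) n').filter (fun bb => IsPrimitiveVec bb.1 ∧ IsPrimitiveVec bb.2 ∧
      Δ₀ < (Dhcf bb : ℝ) ∧ tIdx N (Dhcf bb) = t) with hQ
  -- facts for `bb ∈ Q`
  have hQfacts : ∀ bb ∈ Q, bb.1 ∈ LC (T / N) n ∧ bb.2 ∈ LC (T / N) n' ∧ IsPrimitiveVec bb.1 ∧ IsPrimitiveVec bb.2 ∧
      Δ₀ < (Dhcf bb : ℝ) ∧ tIdx N (Dhcf bb) = t ∧ GoodB T V (castVec bb.1) ∧ GoodB T V (castVec bb.2) ∧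
      bb.1 ≠ bb.2 ∧ cross3 bb.1 bb.2 ≠ 0 ∧ (Wab X η (aplus bb) bb.1 ∧ Wab X η (aplus bb) bb.2) := by
    intro bb hbb
    rw [hQ, mem_filter, mem_product] at hbb
    obtain ⟨⟨hb1, hb2⟩, hp1, hp2, hD, ht⟩ := hbb
    have c1 := castVec_mem_realCell hs hb1
    have c2 := castVec_mem_realCell hs hb2
    obtain ⟨g1, g2, hR⟩ := hI _ c1 _ c2
    have hne : bb.1 ≠ bb.2 := by
      intro h
      rw [mem_LC_iff hs] at hb1 hb2
      exact hnn' (hb1.symm.trans (h ▸ hb2))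
    have hpos1 : 0 < ell (castVec bb.1) := lt_trans hT g1.1.1
    have hpos2 : 0 < ell (castVec bb.2) := lt_trans hT g2.1.1
    have hv : cross3 bb.1 bb.2 ≠ 0 := cross3_ne_zero_of_ne hp1 hp2 hne hpos1 hpos2
    have hDr : (Dhcf bb : ℝ) ∈ Drange N t := mem_Drange_of_tIdx hN (one_le_hcf3 hv) ht
    have hRD := hR _ hDr
    rw [RDR_castVec_iff] at hRD
    exact ⟨hb1, hb2, hp1, hp2, hD, ht, g1, g2, hne, hv, (Wplus_iff_RDplus hX.le hv).mpr hRD⟩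
  -- `F = f` on `Q`
  have hFf : ∀ bb ∈ Q, Fb X τ m V T bb.1 = fWeight X τ m (Ideal.span {coordElt bb.1}) ∧
      Fb X τ m V T bb.2 = fWeight X τ m (Ideal.span {coordElt bb.2}) := by
    intro bb hbb
    obtain ⟨-, -, hp1, hp2, -, -, g1, g2, -, -, -⟩ := hQfacts bb hbb
    have key : ∀ b, IsPrimitiveVec b → GoodB T V (castVec b) → Fb X τ m V T b = fWeight X τ m (Ideal.span {coordElt b}) := by
      intro b hp hg
      have hw := window_of_goodB hg
      have hN := (goodB_castVec_iff (V := V) hT hw).mp hg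
      rw [Fb, if_pos ⟨hw, hp⟩, gCut, if_pos hN]
    exact ⟨key _ hp1 g1, key _ hp2 g2⟩
  -- the index set of `S₅` is `Q ∩ {F ≠ 0}`
  have hset : (PP X η τ m V T Δ₀).filter (fun bb => cellOf N (T / N) bb = (t, n, n')) =
      Q.filter (fun bb => Fb X τ m V T bb.1 ≠ 0 ∧ Fb X τ m V T bb.2 ≠ 0) := by
    ext bb
    rw [mem_filter, mem_filter]
    constructor
    · rintro ⟨hPP, hcell⟩
      obtain ⟨hoff, hD, hW, hF1, hF2, -⟩ := PP_facts hX hT hTV hPP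
      rw [cellOf, Prod.ext_iff, Prod.ext_iff] at hcell
      obtain ⟨ht, hn, hn'⟩ := hcell
      simp only at ht hn hn'
      obtain ⟨-, hp1, -⟩ := support_of_Fb_ne_zero hF1
      obtain ⟨-, hp2, -⟩ := support_of_Fb_ne_zero hF2
      refine ⟨?_, hF1, hF2⟩
      rw [hQ, mem_filter, mem_product, mem_LC_iff hs, mem_LC_iff hs]
      exact ⟨⟨hn, hn'⟩, hp1, hp2, hD, ht⟩
    · rintro ⟨hbb, hF1, hF2⟩
      obtain ⟨hb1, hb2, -, -, hD, ht, -, -, hne, -, hW⟩ := hQfacts bb hbb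
      obtain ⟨hw1, -, hN1⟩ := support_of_Fb_ne_zero hF1
      obtain ⟨hw2, -, hN2⟩ := support_of_Fb_ne_zero hF2
      -- `b_i ∈ Bbox`
      have hB : ∀ b, InWindow T (coordElt b) → (Ideal.absNorm (Ideal.span {coordElt b}) : ℝ) ≤ 2 * V → b ∈ Bbox T := by
        intro b hw hN2
        have hNb := absNorm_eq_normForm_of_inWindow hT hw
        have hell1 : T < ell (castVec b) := by have := hw.1; rwa [ellO_coordElt] at this
        have hell2 : ell (castVec b) ≤ unitE * T := by have := hw.2; rwa [ellO_coordElt] at this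
        obtain ⟨a1, a2, a3⟩ := abs_coord_le_of_inWindow hT hTV hell1 hell2 (by rw [← hNb]; exact hN2)
        exact mem_cube_of_abs_le a1 a2 a3
      refine ⟨?_, ?_⟩
      · rw [PP, mem_filter, mem_offDiag]
        exact ⟨⟨hB _ hw1 hN1.2, hB _ hw2 hN2.2, hne⟩, hD, hW, hF1, hF2⟩
      · rw [cellOf, ht, (mem_LC_iff hs).mp hb1, (mem_LC_iff hs).mp hb2]
  rw [S5, hset, sum_filter_of_ne (fun bb _ hne => mul_ne_zero_iff.mp hne), S6, ← hQ]
  exact sum_congr rfl fun bb hbb => by rw [(hFf bb hbb).1, (hFf bb hbb).2]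

/-! ### Any hypercube: `|S₅| ≤ (81/2)(S₇ + S₇')` -/

open scoped Classical in
/-- **The trivial bound for a hypercube** ("`τ(β₁)τ(β₂) ≤ τ(β₁)² + τ(β₂)²`" and `|F_β| ≤ 9τ(β)`):
`|S₅(t, C₁, C₂)| ≤ (81/2)(∑_D ∑_{β̂₁ ∈ C₁ prim} ∑_{β̂₂ ∈ C₂, D ∣ β̂₁∧β̂₂} τ(β₁)² + ∑_D ∑_{β̂₂ ∈ C₂ prim} ∑_{β̂₁ ∈ C₁, D ∣ β̂₂∧β̂₁} τ(β₂)²)`,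
`D` over `Dset t` — the sums `S₇` of Lemma 12.1, ready for Lemma 11.1. [cite: HeathBrownActa2001, Lemma 12.1] -/
theorem abs_S5_le_S7 (hX : 1 < X) (hη1 : η ≤ 1) (hτ : 0 < τ) (hτ1 : τ ≤ 1) {nn : ℕ} {m : Fin (nn + 1) → ℕ}
    (hm : CoreAdmissible τ m) (hT : 0 < T) (hTV : T ^ 3 = V) {N : ℕ} (hN : 0 < N) {Δ₀ : ℝ} (t : ℕ)
    (n n' : ℤ × ℤ × ℤ) :
    |S5 X η τ m V T N Δ₀ (t, n, n')| ≤ (81 / 2) *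
      ((∑ D ∈ Dset X V N Δ₀ t, ∑ b₁ ∈ (LC (T / N) n).filter IsPrimitiveVec,
          ∑ _b₂ ∈ (LC (T / N) n').filter (fun b₂ => DvdVec (D : ℤ) (cross3 b₁ b₂)),
            (idealDivisorCount (Ideal.span {coordElt b₁}) : ℝ) ^ 2) +
        (∑ D ∈ Dset X V N Δ₀ t, ∑ b₂ ∈ (LC (T / N) n').filter IsPrimitiveVec,
          ∑ _b₁ ∈ (LC (T / N) n).filter (fun b₁ => DvdVec (D : ℤ) (cross3 b₂ b₁)),
            (idealDivisorCount (Ideal.span {coordElt b₂}) : ℝ) ^ 2)) := by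
  classical
  have hX0 : 0 < X := by linarith
  have hNR : (0 : ℝ) < N := by exact_mod_cast hN
  set s : ℝ := T / N with hs
  have hs0 : 0 < s := by rw [hs]; positivity
  set Q' := (LC s n ×ˢ LC s n').filter (fun bb => IsPrimitiveVec bb.1 ∧ IsPrimitiveVec bb.2 ∧
      Dhcf bb ∈ Dset X V N Δ₀ t) with hQ'
  set τ₁ : (ℤ × ℤ × ℤ) × (ℤ × ℤ × ℤ) → ℝ := fun bb => (idealDivisorCount (Ideal.span {coordElt bb.1}) : ℝ) ^ 2 with hτ₁
  set τ₂ : (ℤ × ℤ × ℤ) × (ℤ × ℤ × ℤ) → ℝ := fun bb => (idealDivisorCount (Ideal.span {coordElt bb.2}) : ℝ) ^ 2 with hτ₂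
  -- Step 1: `|S₅| ≤ ∑_{PPcell} (F₁² + F₂²)/2 ≤ ∑_{Q'} (81/2)(τ₁ + τ₂)`
  have hsub : (PP X η τ m V T Δ₀).filter (fun bb => cellOf N s bb = (t, n, n')) ⊆ Q' := by
    intro bb hbb
    rw [mem_filter] at hbb
    obtain ⟨hPP, hcell⟩ := hbb
    obtain ⟨hoff, hD, hW, hF1, hF2, hDmax⟩ := PP_facts hX0 hT hTV hPP
    rw [cellOf, Prod.ext_iff, Prod.ext_iff] at hcell
    obtain ⟨ht, hn, hn'⟩ := hcell
    simp only at ht hn hn'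
    obtain ⟨-, hp1, -⟩ := support_of_Fb_ne_zero hF1
    obtain ⟨-, hp2, -⟩ := support_of_Fb_ne_zero hF2
    have hne : bb.1 ≠ bb.2 := (mem_offDiag.mp hoff).2.2
    have hv : cross3 bb.1 bb.2 ≠ 0 := cross3_ne_zero_of_Wab hX0.le hη1 hp1 hne hW.1 hW.2
    rw [hQ', mem_filter, mem_product]
    refine ⟨?_, hp1, hp2, ?_⟩
    · rw [mem_LC_iff hs0, mem_LC_iff hs0]; exact ⟨hn, hn'⟩
    · rw [Dset, mem_filter, mem_Icc]
      exact ⟨⟨one_le_hcf3 hv, Nat.le_floor hDmax⟩, hD, ht⟩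
  have h1 : |S5 X η τ m V T N Δ₀ (t, n, n')| ≤ ∑ bb ∈ Q', (81 / 2) * (τ₁ bb + τ₂ bb) := by
    rw [S5, ← hs]
    refine (abs_sum_le_sum_abs _ _).trans ?_
    refine (sum_le_sum_of_subset_of_nonneg hsub (fun _ _ _ => abs_nonneg _)).trans (sum_le_sum fun bb _ => ?_)
    rw [abs_mul]
    have e1 := Fb_sq_le (V := V) (T := T) hX hτ hτ1 hm bb.1
    have e2 := Fb_sq_le (V := V) (T := T) hX hτ hτ1 hm bb.2
    simp only [hτ₁, hτ₂]
    nlinarith [sq_nonneg (|Fb X τ m V T bb.1| - |Fb X τ m V T bb.2|), sq_abs (Fb X τ m V T bb.1),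
      sq_abs (Fb X τ m V T bb.2), abs_nonneg (Fb X τ m V T bb.1), abs_nonneg (Fb X τ m V T bb.2)]
  refine h1.trans ?_
  rw [← mul_sum, sum_add_distrib]
  refine mul_le_mul_of_nonneg_left (add_le_add ?_ ?_) (by norm_num)
  · -- `∑_{Q'} τ₁ ≤ S₇`
    rw [← sum_fiberwise_of_maps_to (g := fun bb => Dhcf bb) (t := Dset X V N Δ₀ t)
      (fun bb hbb => by rw [hQ', mem_filter] at hbb; exact hbb.2.2.2)]
    refine sum_le_sum fun D hD => ?_
    calc ∑ bb ∈ Q'.filter (fun bb => Dhcf bb = D), τ₁ bb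
        ≤ ∑ bb ∈ (LC s n ×ˢ LC s n').filter (fun bb => IsPrimitiveVec bb.1 ∧ DvdVec (D : ℤ) (cross3 bb.1 bb.2)), τ₁ bb := by
          refine sum_le_sum_of_subset_of_nonneg (fun bb hbb => ?_) (fun _ _ _ => by positivity)
          rw [mem_filter, hQ', mem_filter] at hbb
          obtain ⟨⟨hprod, hp1, -, -⟩, hDeq⟩ := hbb
          rw [mem_filter]
          refine ⟨hprod, hp1, ?_⟩
          rw [← hDeq]; exact hcf3_dvd _
      _ = _ := by
          rw [sum_filter, sum_product, sum_filter]
          refine sum_congr rfl fun b₁ _ => ?_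
          by_cases hp : IsPrimitiveVec b₁
          · rw [if_pos hp, sum_filter]
            refine sum_congr rfl fun b₂ _ => ?_
            simp only [hp, true_and, hτ₁]
          · rw [if_neg hp]
            exact sum_eq_zero fun b₂ _ => if_neg (fun h => hp h.1)
  · rw [← sum_fiberwise_of_maps_to (g := fun bb => Dhcf bb) (t := Dset X V N Δ₀ t)
      (fun bb hbb => by rw [hQ', mem_filter] at hbb; exact hbb.2.2.2)]
    refine sum_le_sum fun D hD => ?_
    calc ∑ bb ∈ Q'.filter (fun bb => Dhcf bb = D), τ₂ bb
        ≤ ∑ bb ∈ (LC s n ×ˢ LC s n').filter (fun bb => IsPrimitiveVec bb.2 ∧ DvdVec (D : ℤ) (cross3 bb.2 bb.1)), τ₂ bb := by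
          refine sum_le_sum_of_subset_of_nonneg (fun bb hbb => ?_) (fun _ _ _ => by positivity)
          rw [mem_filter, hQ', mem_filter] at hbb
          obtain ⟨⟨hprod, -, hp2, -⟩, hDeq⟩ := hbb
          rw [mem_filter]
          refine ⟨hprod, hp2, ?_⟩
          rw [← hDeq, cross3_swap]
          obtain ⟨d1, d2, d3⟩ : DvdVec (Dhcf bb : ℤ) (cross3 bb.1 bb.2) := hcf3_dvd _
          refine ⟨?_, ?_, ?_⟩ <;> simp only [Prod.fst_neg, Prod.snd_neg, dvd_neg] <;> assumption
      _ = _ := by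
          rw [sum_filter, sum_product_right, sum_filter]
          refine sum_congr rfl fun b₂ _ => ?_
          by_cases hp : IsPrimitiveVec b₂
          · rw [if_pos hp, sum_filter]
            refine sum_congr rfl fun b₁ _ => ?_
            simp only [hp, true_and, hτ₂]
          · rw [if_neg hp]
            exact sum_eq_zero fun b₁ _ => if_neg (fun h => hp h.1)

/-! ### The `D` of a cell: `∑ D⁻² ≤ 5/(NΔ₀)` -/

/-- `e^{1/N} ≤ 1 + 2/N` (`N ≥ 1`). [folklore] -/
theorem exp_inv_le {N : ℕ} (hN : 0 < N) : Real.exp (1 / (N : ℝ)) ≤ 1 + 2 / N := by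
  have hNR : (1 : ℝ) ≤ N := by exact_mod_cast hN
  have hx1 : 1 / (N : ℝ) ≤ 1 := by rw [div_le_one (by linarith)]; exact hNR
  have hx0 : 0 ≤ 1 / (N : ℝ) := by positivity
  have h := Real.abs_exp_sub_one_sub_id_le (x := 1 / (N : ℝ)) (by rw [abs_of_nonneg hx0]; exact hx1)
  rw [abs_le] at h
  have hsq : (1 / (N : ℝ)) ^ 2 ≤ 1 / N := by
    rw [sq]; exact mul_le_of_le_one_left hx0 hx1
  have e2 : (2 : ℝ) / N = 2 * (1 / N) := by ring
  rw [e2]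
  linarith [h.2]

open scoped Classical in
/-- **`∑_{D ∈ Dset t} D⁻² ≤ 2/(NΔ₀) + 3/Δ₀²`** (`Δ₀ > 0`): the `D` of the cell lie in `[A, Ae^{1/N})` with
`A > Δ₀/3`, so there are `≤ 2A/N + 1` of them, each `> Δ₀` (Heath-Brown: "`∑_{D ∈ I_m} D⁻² ≪ A⁻¹N⁻¹`").
[cite: HeathBrownActa2001, §12 p. 75] -/
theorem sum_Dset_inv_sq_le {N : ℕ} (hN : 0 < N) {Δ₀ : ℝ} (hΔ0 : 0 < Δ₀) (t : ℕ) :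
    ∑ D ∈ Dset X V N Δ₀ t, ((D : ℝ) ^ 2)⁻¹ ≤ 2 / (N * Δ₀) + 3 / Δ₀ ^ 2 := by
  classical
  have hNR : (0 : ℝ) < N := by exact_mod_cast hN
  set S := Dset X V N Δ₀ t with hS
  rcases S.eq_empty_or_nonempty with he | ⟨D₀, hD₀⟩
  · rw [he, sum_empty]; positivity
  set A : ℝ := Real.exp ((t : ℝ) / N) with hA
  have hApos : 0 < A := Real.exp_pos _
  have hexpN := exp_inv_le hN
  -- every `D ∈ S`: `Δ₀ < D`, `A ≤ D ≤ A e^{1/N}`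
  have hmem : ∀ D ∈ S, Δ₀ < (D : ℝ) ∧ A ≤ D ∧ (D : ℝ) ≤ A * Real.exp (1 / (N : ℝ)) := by
    intro D hD
    rw [hS, Dset, mem_filter, mem_Icc] at hD
    obtain ⟨⟨hD1, -⟩, hΔD, ht⟩ := hD
    obtain ⟨h1, h2⟩ := mem_Drange_of_tIdx hN hD1 ht
    refine ⟨hΔD, h1, ?_⟩
    rw [hA, ← Real.exp_add]
    convert h2 using 2; field_simp
  -- `A > Δ₀/3`
  have hAΔ : Δ₀ / 3 < A := by
    obtain ⟨h1, -, h3⟩ := hmem D₀ hD₀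
    have he3 : Real.exp (1 / (N : ℝ)) ≤ 3 := by
      have hN1 : (1 : ℝ) ≤ N := by exact_mod_cast hN
      have : (2 : ℝ) / N ≤ 2 := by rw [div_le_iff₀ hNR]; nlinarith
      linarith
    nlinarith
  -- `#S ≤ 2A/N + 1`
  have hcard : (#S : ℝ) ≤ A * (2 / N) + 1 := by
    have hinj : Set.InjOn (fun D : ℕ => (D : ℤ)) (S : Set ℕ) := Nat.cast_injective.injOn
    rw [← card_image_of_injOn hinj]
    refine card_int_le_of_forall_mem_Icc (a := A) (L := A * (2 / N)) (by positivity) fun z hz => ?_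
    obtain ⟨D, hD, rfl⟩ := mem_image.mp hz
    obtain ⟨-, h2, h3⟩ := hmem D hD
    push_cast
    refine ⟨h2, h3.trans ?_⟩
    nlinarith
  -- each term `≤ 1/(A Δ₀)`
  have hterm : ∀ D ∈ S, ((D : ℝ) ^ 2)⁻¹ ≤ (A * Δ₀)⁻¹ := by
    intro D hD
    obtain ⟨h1, h2, -⟩ := hmem D hD
    apply inv_anti₀ (by positivity)
    rw [sq]; exact mul_le_mul h2 h1.le hΔ0.le (by linarith)
  calc ∑ D ∈ S, ((D : ℝ) ^ 2)⁻¹ ≤ ∑ _D ∈ S, (A * Δ₀)⁻¹ := sum_le_sum hterm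
    _ = #S * (A * Δ₀)⁻¹ := by rw [sum_const, nsmul_eq_mul]
    _ ≤ (A * (2 / N) + 1) * (A * Δ₀)⁻¹ := by gcongr
    _ = 2 / (N * Δ₀) + 1 / (A * Δ₀) := by field_simp
    _ ≤ 2 / (N * Δ₀) + 3 / Δ₀ ^ 2 := by
        have h1A : 1 / (A * Δ₀) ≤ 3 / Δ₀ ^ 2 := by
          rw [div_le_div_iff₀ (by positivity) (by positivity)]
          nlinarith
        linarith

end Literature.NumberTheory.Sieve.CubicSieve

end
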